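import Summits.BirchSwinnertonDyer.Rank1Residual.X11b.Three.OpenInputTight
import Literature.NumberTheory.EllipticCurves.KolyvaginShaStructure
import Literature.NumberTheory.EllipticCurves.Rank1Residual.Typed.KolyvaginCertificate
import Literature.NumberTheory.EllipticCurves.RootNumberEvenAnalyticRankProofs
import Literature.NumberTheory.EllipticCurves.BSDSelmerSkinnerProofs
import HarnessLib

/-!
# X11b at `p = 3` (team N8/O2, LINE K, sub-target K-CERT3): ONE non-divisible derived Heegner
# point closes `BSD(E,p)` per pair in analytic rank one — the kernel consumer of Kolyvagin's
# structure theorem (McCallum 1991) at an odd prime, `p = 3` included (cell `b2b-bsdres`, team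
# `x11b3`, seat p7)

HONEST FRAMING (verbatim, cell `b2b-bsdres`, run/shared/lean/b2b/bsd-rank1-residual/): the goal of
the cell is to DELETE the COMBINATION-SHAPED residual classes for ALL analytic-rank `≤ 1` curves
over `ℚ` — "full BSD formula for every rank `≤ 1` curve in class `C`" assembled STRICTLY from
published theorems — so that the rank-`≤ 1` remainder becomes exactly the CONSTRUCTION-SHAPED
classes, which are TYPED (missing-input Props), NOT attempted; this is not "finishing BSD".
Research route (team N8/O2: STEP L at `3 ‖ N`; LINE K = the Kolyvagin-system architecture,
`cells/x11b3/LINE-K.md` K0⋆ / K5 / E1-K); PER-PAIR certificate consumer, NOT a class theorem;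
nothing booked; no label touched; X11b@3 stays OPEN (RESIDUAL-MAP §I O2). THEOREMS ONLY; no
definition; no NEW named fact; no `sorry`.

## What this file does

LINE K at `3` (team `LINE-K.md`, K0⋆): at an X11b@3 pair on atom A1 (`3 ∤ ∏ c_ℓ`), STEP L ⟺
`M_∞ = 0` ⟺ SOME of Kolyvagin's derived classes is non-zero — Kolyvagin's conjecture at `3 ‖ N`, for
which no printed architecture exists (K1 level raising is void at `3`; LINE W unbuilt). Kolyvagin's
STRUCTURE THEOREM itself (Kolyvagin 1991 / McCallum 1991 §1 Theorem, Thm. 5.4, Thm. 5.8: "Let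
`p > 2` …") has NO hypothesis on the reduction of `E` at `p` and is printed for every odd `p`; the
tree vendors its level-one certificate form as the named fact
`McCallum1991_card_sha_primary_of_derivedPoint_not_divisible` (`KolyvaginShaStructure.lean`, team
n1011 seat p10; image hypothesis typed as `p`-adic tower surjectivity, flag `McCallum91-padic-image`):
ONE Kolyvagin prime `ℓ` with `P_ℓ ∉ pE(K_ℓ)` gives `#Ш(E/K)[p^∞] = p^{2M₀}` and, in the `w(E) = −1`
branch, `#Ш(E/ℚ)[p^∞] = 1`. This file is its FIRST rank-one consumer:

* §1 `Three.bsdp_of_mccallumCertificate` (CLASS-FREE, any odd `p`): `ord_{s=1} L(E,s) = 1`, no CM,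
  `K` imaginary quadratic Heegner for `N_E` with `d_K ∉ {−3, −4}`, `ρ̄_{E,p^n}` onto for all `n`, the
  Heegner point `y_K = P_1` of infinite order with `p^{M₀} ∥ y_K` in `E(K_1)`, ONE Kolyvagin prime
  `ℓ` (`ℓ ∤ N d_K p`, `ℓ` inert, `p ∣ ℓ + 1`, `p ∣ a_ℓ`) with `P_ℓ ∉ pE(K_ℓ)`, and the lane's exact
  `#Ш(E)_an = q` with `ord_p q = 0` ⟹ `BSD(E,p)`. Proof: modularity gives `w(E) = (−1)^{r_an} = −1`,
  the fact gives `#Ш(E/ℚ)[p^∞] = 1`, hence `Ш(E)[p] = 0`, and `Typed.bsdp_of_shaAn_unit_of_noPTorsion`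
  (GZK + Miller's Def. 1.1) concludes. `Three.bsdp_three_of_mccallumCertificate` is the `p = 3` row
  on an X11b@3 pair (`r_an = 1`, `3 ≠ 2`, multiplicative `3` ⇒ no CM).
* §2 `Three.P2.openInputOnTreeOddAt_three_of_mccallumCertificate` — hence THE open input of route
  p2 HOLDS at such a pair with a (ram) prime, given the PUB-shaped control identity at `3` (S1,
  `P2.openInputOnTreeOddAt_of_bsdp_of_ram`): every McCallum certificate is a verified instance of
  STEP L at `3` modulo published facts + (CTL).

READING (E1-K / E4, team PLAN §5; r2's amendment (ii) "r = 1 suffices iff `3 ∤ #Ш(E/ℚ)_an`"): a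
SECOND per-pair instrument endpoint for the true-open X11b@3 classes (1 639 of 1 684 have
`3 ∤ Ш_an`), INDEPENDENT of exact `3`-descent — the certificate (`K`, `M₀`, one Kolyvagin prime `ℓ`,
the non-divisibility `P_ℓ ∉ 3E(K_ℓ)` by the Jetchev–Lauter–Stein algorithm) is what instrument
cc-eng-5 would emit. Nothing here computes or books one.

What this is NOT: not a class theorem (the certificate is per pair and its existence is Kolyvagin's
conjecture at `3 ‖ N`); the vendored fact's binders (no CM, `d_K ∉ {−3,−4}`, tower surjectivity) are
carried verbatim — the tower binder could be downgraded to `Surj W 3` via team S7's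
`Three/ImageNegOne*.lean` only by the fact's owner / referee; X11b@3 stays OPEN.

References: W. G. McCallum, *Kolyvagin's work on Shafarevich–Tate groups*, LMS LN 153 (1991) §1
Theorem p. 296, Thm. 5.4 p. 308, Thm. 5.8 p. 310 [McCallumLMS1991]; V. A. Kolyvagin, Math. Ann. 291
(1991) §2 [Kolyvagin1991MathAnn]; B. H. Gross, LMS LN 153 (1991) §3–§4 [GrossLMS1991];
D. Jetchev, K. Lauter, W. Stein, *Explicit Heegner points: Kolyvagin's conjecture and non-trivial
elements in the Shafarevich–Tate group*, J. Number Theory 129 (2009) (the instrument); R. L. Miller,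
LMS J. Comput. Math. 14 (2011) Def. 1.1 [Miller2011LMS]; team files `cells/x11b3/LINE-K.md` K0⋆, K5,
E1-K; `cells/x11b3/PLAN.md` §5.
-/

noncomputable section

open scoped Classical

open WeierstrassCurve NumberField IsDedekindDomain Field
open Literature.NumberTheory.EllipticCurves Literature.NumberTheory.EllipticCurves.GreenbergSelmer
  Literature.NumberTheory.EllipticCurves.ModularForms
  Literature.NumberTheory.EllipticCurves.Rank1Residual
  Literature.NumberTheory.EllipticCurves.Rank1Residual.Typed
  Literature.NumberTheory.EllipticCurves.Wuthrich2014
  Literature.NumberTheory.EllipticCurves.BalakrishnanEtAl2019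
  Literature.NumberTheory.QuadraticFields.Quadratic
  Literature.NumberTheory.Automorphic
  Literature.NumberTheory.GaloisRepresentations Literature.NumberTheory.GaloisCohomology
  Summit.BirchSwinnertonDyer.Rank1Residual.X11b.AcSelmer
  Summit.BirchSwinnertonDyer.Rank1Residual.X11b.LocBridge

namespace Summit.BirchSwinnertonDyer.Rank1Residual.X11b.Three

/-! ### §0. From `#Ш(E)[p^∞] = 1` to `Ш(E)[p] = 0` -/

/-- If the `p`-primary component of an additive commutative group has exactly one element, the group
has no element killed by `p` other than `0`. [folklore] -/
theorem eq_zero_of_zsmul_eq_zero_of_card_primaryComponent_eq_one {A : Type*} [AddCommGroup A]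
    {p : ℕ} (hcard : Nat.card (AddCommGroup.primaryComponent A p) = 1) (x : A)
    (hx : (p : ℤ) • x = 0) : x = 0 := by
  obtain ⟨z, hz⟩ := Nat.card_eq_one_iff_exists.mp hcard
  have hxmem : x ∈ AddCommGroup.primaryComponent A p :=
    AddCommGroup.mem_primaryComponent.mpr ⟨1, by rw [pow_one, ← natCast_zsmul]; exact hx⟩
  have e := (hz ⟨x, hxmem⟩).trans (hz ⟨0, AddSubgroup.zero_mem _⟩).symm
  exact congrArg Subtype.val e

/-! ### §1. The certificate consumer, any odd prime (class-free) and the `p = 3` row -/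

section Certificate

variable (W : WeierstrassCurve ℚ) [W.IsElliptic] [W.IsGloballyMinimal] [NeZero (W.conductorNorm ℤ)]
  (p : ℕ) [Fact p.Prime]

/-- **One non-divisible derived Heegner point closes `BSD(E,p)` in analytic rank one (any odd `p`,
class-free, per pair).** Inputs: the vendored McCallum fact
(`McCallum1991_card_sha_primary_of_derivedPoint_not_divisible`: Kolyvagin 1991 / McCallum 1991 §1
Theorem + Thm. 5.4, "`p > 2`", image typed as tower surjectivity), Gross–Zagier–Kolyvagin over `ℚ`
(`hGZK`), modularity (`hnf`, for `w(E) = (−1)^{r_an}`); the pair: `ord_{s=1} L(E,s) = 1`, no CM; the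
CERTIFICATE: `K` imaginary quadratic with `d_K ∉ {−3,−4}` and the Heegner hypothesis for `N = N_E`,
`ρ̄_{E,p^n}` onto for every `n`, a conductor-one Kolyvagin–Heegner datum `d₁` over `(Dt, β, ι)` whose
point `y_K = P_1` has infinite order and `p^{M₀} ∥ y_K` in `E(K_1)`, ONE Kolyvagin prime `ℓ`
(`Zhang2014.IsKolyvaginPrime`: `ℓ ∤ N`, `ℓ ∤ d_K`, `ℓ ≠ p`, `ℓ` inert, `p ∣ ℓ + 1`, `p ∣ a_ℓ`) with a
datum `d` whose derived point satisfies `P_ℓ ∉ pE(K_ℓ)`, and the exact `#Ш(E)_an = q ∈ ℚ` with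
`ord_p q = 0`. CONCLUSION `BSD(E,p)`: the fact's `w(E) = −1` branch gives `#Ш(E/ℚ)[p^∞] = 1`, so
`Ш(E)[p] = 0`, and `Typed.bsdp_of_shaAn_unit_of_noPTorsion` (Miller's Def. 1.1 bookkeeping) ends.
NOT a class theorem; the existence of such an `ℓ` is Kolyvagin's conjecture.
[cite: McCallumLMS1991, §1 Theorem (p. 296), Thm. 5.4 (p. 308), Thm. 5.8 (p. 310)]
[cite: Kolyvagin1991MathAnn, §2 (p. 258)] [cite: Miller2011LMS, §1 and Def. 1.1] -/
theorem bsdp_of_mccallumCertificate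
    (hMc : McCallum1991_card_sha_primary_of_derivedPoint_not_divisible)
    (hGZK : rank_eq_analyticRank_of_analyticRank_le_one) (hnf : exists_isNewformOf)
    -- the pair
    (hp2 : p ≠ 2) (hr : W.analyticRank = 1) (hCM : ¬ W.HasCM)
    -- the certificate: field, image, Heegner datum, divisibility exponent, one Kolyvagin prime
    (K : Type) [Field K] [NumberField K] (hK : IsImaginaryQuadratic K)
    (hD3 : NumberField.discr K ≠ -3) (hD4 : NumberField.discr K ≠ -4)
    (hH : SatisfiesHeegnerHypothesis (W.conductorNorm ℤ) K)
    (htower : ∀ n : ℕ, W.HasSurjectiveModNGaloisRep (p ^ n : ℕ))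
    (Dt : ModularParametrizationData W (W.conductorNorm ℤ)) (β : ℤ) (ι : K →+* ℂ)
    (d₁ : KolyvaginHeegnerData Dt β ι 1) (hy : ¬ IsOfFinAddOrder d₁.derivedPoint) (M₀ : ℕ)
    (hdiv : ∃ Q : (W.baseChange (ringClassField K ι 1)).toAffine.Point,
      ((p ^ M₀ : ℕ) : ℤ) • Q = d₁.derivedPoint)
    (hndiv : ¬ ∃ Q : (W.baseChange (ringClassField K ι 1)).toAffine.Point,
      ((p ^ (M₀ + 1) : ℕ) : ℤ) • Q = d₁.derivedPoint)
    (ℓ : ℕ) (d : KolyvaginHeegnerData Dt β ι ℓ)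
    (hℓ : Zhang2014.IsKolyvaginPrime (W.conductorNorm ℤ) W K p ℓ)
    (hcert : ¬ ∃ Q : (W.baseChange (ringClassField K ι ℓ)).toAffine.Point,
      (p : ℤ) • Q = d.derivedPoint)
    -- the lane's exact analytic order of Ш, a `p`-adic unit
    {q : ℚ} (hq : shaAn W = (q : ℂ)) (hv : padicValRat p q = 0) : BSDp W p := by
  have hD0 : (NumberField.discr K : ℚ) ≠ 0 := by exact_mod_cast NumberField.discr_ne_zero K
  haveI : (W.quadraticTwist (NumberField.discr K : ℚ)).IsElliptic :=
    W.isElliptic_quadraticTwist hD0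
  -- `w(E) = (−1)^{r_an} = −1`
  have hw : W.rootNumber = -1 := by
    rw [WeierstrassCurve.rootNumber_eq_neg_one_pow_analyticRank_of_exists_isNewformOf hnf W, hr]
    norm_num
  -- the structure theorem at the certificate
  obtain ⟨-, -, hneg⟩ := hMc W hCM K hK hD3 hD4 hH p hp2 htower Dt β ι d₁ hy M₀ hdiv hndiv ℓ d hℓ
    hcert (W.quadraticTwist (NumberField.discr K : ℚ)) ⟨1, one_smul _ _⟩
  have hcard : Nat.card (AddCommGroup.primaryComponent W.sha p) = 1 := (hneg hw).1
  -- `Ш(E)[p] = 0`, then Miller's bookkeeping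
  exact bsdp_of_shaAn_unit_of_noPTorsion W p hGZK (le_of_eq hr) hq hv
    fun x hx ↦ eq_zero_of_zsmul_eq_zero_of_card_primaryComponent_eq_one hcard x hx

/-- **The `p = 3` row on an X11b@3 pair** (`ClassX11b W 3`: `r_an = 1`, `3 ≠ 2`, multiplicative at
`3` — hence no CM, `not_hasCM_of_hasMultiplicativeReductionAtPrime'` — `E[3]` irreducible): ONE
McCallum certificate at `3` (field, `3`-adic tower surjectivity, `3^{M₀} ∥ y_K`, one Kolyvagin prime
`ℓ` with `P_ℓ ∉ 3E(K_ℓ)`) and `ord_3 #Ш(E)_an = 0` give `BSD(E,3)`. Per pair; NOT a class theorem;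
X11b@3 stays OPEN. [cite: McCallumLMS1991, §1 Theorem (p. 296), Thm. 5.4 (p. 308)]
[cite: Miller2011LMS, §1 and Def. 1.1] -/
theorem bsdp_three_of_mccallumCertificate [Fact (Nat.Prime 3)]
    (hMc : McCallum1991_card_sha_primary_of_derivedPoint_not_divisible)
    (hGZK : rank_eq_analyticRank_of_analyticRank_le_one) (hnf : exists_isNewformOf)
    (hX : ClassX11b W 3)
    (K : Type) [Field K] [NumberField K] (hK : IsImaginaryQuadratic K)
    (hD3 : NumberField.discr K ≠ -3) (hD4 : NumberField.discr K ≠ -4)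
    (hH : SatisfiesHeegnerHypothesis (W.conductorNorm ℤ) K)
    (htower : ∀ n : ℕ, W.HasSurjectiveModNGaloisRep (3 ^ n : ℕ))
    (Dt : ModularParametrizationData W (W.conductorNorm ℤ)) (β : ℤ) (ι : K →+* ℂ)
    (d₁ : KolyvaginHeegnerData Dt β ι 1) (hy : ¬ IsOfFinAddOrder d₁.derivedPoint) (M₀ : ℕ)
    (hdiv : ∃ Q : (W.baseChange (ringClassField K ι 1)).toAffine.Point,
      ((3 ^ M₀ : ℕ) : ℤ) • Q = d₁.derivedPoint)
    (hndiv : ¬ ∃ Q : (W.baseChange (ringClassField K ι 1)).toAffine.Point,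
      ((3 ^ (M₀ + 1) : ℕ) : ℤ) • Q = d₁.derivedPoint)
    (ℓ : ℕ) (d : KolyvaginHeegnerData Dt β ι ℓ)
    (hℓ : Zhang2014.IsKolyvaginPrime (W.conductorNorm ℤ) W K 3 ℓ)
    (hcert : ¬ ∃ Q : (W.baseChange (ringClassField K ι ℓ)).toAffine.Point,
      ((3 : ℕ) : ℤ) • Q = d.derivedPoint)
    {q : ℚ} (hq : shaAn W = (q : ℂ)) (hv : padicValRat 3 q = 0) : BSDp W 3 :=
  bsdp_of_mccallumCertificate W 3 hMc hGZK hnf hX.2.1 hX.1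
    (not_hasCM_of_hasMultiplicativeReductionAtPrime' W hX.2.2.1) K hK hD3 hD4 hH htower Dt β ι d₁
    hy M₀ hdiv hndiv ℓ d hℓ hcert hq hv

end Certificate

/-! ### §2. Hence THE open input at `3` at such a pair (given the control identity) -/

section OpenInput

variable (W : WeierstrassCurve ℚ) [W.IsElliptic] [W.IsGloballyMinimal] [NeZero (W.conductorNorm ℤ)]

/-- **A McCallum certificate at `3` is an instance of STEP L at `3`**: on an X11b@3 pair with a (ram)
prime, ONE certificate as in `bsdp_three_of_mccallumCertificate` (+ `ord_3 #Ш(E)_an = 0`) gives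
`BSD(E,3)`, hence — given the PUB-shaped control identity at `3` (inline, labelled as in team S1's
`P2.openInputOnTreeOddAt_of_bsdp_of_ram`; Gross–Zagier, Kolyvagin, Skinner 2016 Thm. C for the
rigidity step) — THE open input `P2OpenInputOnTreeOddAt W 3`. Per pair; nothing booked; X11b@3
stays OPEN. [cite: McCallumLMS1991, §1 Theorem (p. 296), Thm. 5.4 (p. 308)]
[cite: Castella2018, Thm. 2.3 (p. 5), Thm. 3.2 (p. 9)] [cite: Miller2011LMS, §1 and Def. 1.1] -/
theorem P2.openInputOnTreeOddAt_three_of_mccallumCertificate [Fact (Nat.Prime 3)]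
    (hMc : McCallum1991_card_sha_primary_of_derivedPoint_not_divisible)
    (hGZ : ∀ (N : ℕ) [NeZero N] (W : WeierstrassCurve ℚ) (K : Type) [Field K] [NumberField K],
      gross_zagier N W K)
    (hKo : ∀ (N : ℕ) [NeZero N] (W : WeierstrassCurve ℚ) (K : Type) [Field K] [NumberField K],
      kolyvagin N W K)
    (hSk : Skinner2016.thmC_padicValRat_bsd_rank_zero)
    (hGZK : rank_eq_analyticRank_of_analyticRank_le_one) (hmod : hasEntireLFunction_rat)
    (hnf : exists_isNewformOf)
    (hC : ∀ (N : ℕ) [NeZero N] (K : Type) [Field K] [NumberField K]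
      (Dt : ModularParametrizationData W N) (H : HeegnerDatum N (NumberField.discr K)) (ι : K →+* ℂ)
      (P : (W.baseChange K).toAffine.Point),
      ClassX11b W 3 → Surj W 3 → W.conductorNorm ℤ = N → IsImaginaryQuadratic K →
      Odd (NumberField.discr K) → ¬ (3 : ℤ) ∣ NumberField.discr K → ¬ 3 ∣ Units.torsionOrder K →
      SatisfiesHeegnerHypothesis N K →
      (W.quadraticTwist (NumberField.discr K : ℚ)).entireLFunction 1 ≠ 0 →
      WeierstrassCurve.Affine.Point.map ι.toRatAlgHom P = heegnerPointComplex Dt H →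
      ¬ (3 : ℤ) ∣ Dt.c → ¬ IsOfFinAddOrder P →
      ∀ (κ : ZpExtension K 3), κ.IsAnticyclotomic →
        ∀ (γ : Field.absoluteGaloisGroup K) [Fact (κ.IsTopGenerator γ)]
          (𝔭 : HeightOneSpectrum (𝓞 K)) (h𝔭 : ((3 : ℕ) : 𝓞 K) ∈ 𝔭.asIdeal)
          (he : 𝔭.asIdeal.ramificationIdx (𝓞 ℚ) = 1) (hf : 𝔭.asIdeal.inertiaDeg (𝓞 ℚ) = 1),
          ControlOnTreeAt 3 κ 𝔭 γ (embAt K 3 𝔭 h𝔭 he hf) P)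
    (hX : ClassX11b W 3) (hram : Ram W 3)
    -- the McCallum certificate at `3`
    (K : Type) [Field K] [NumberField K] (hK : IsImaginaryQuadratic K)
    (hD3 : NumberField.discr K ≠ -3) (hD4 : NumberField.discr K ≠ -4)
    (hH : SatisfiesHeegnerHypothesis (W.conductorNorm ℤ) K)
    (htower : ∀ n : ℕ, W.HasSurjectiveModNGaloisRep (3 ^ n : ℕ))
    (Dt : ModularParametrizationData W (W.conductorNorm ℤ)) (β : ℤ) (ι : K →+* ℂ)
    (d₁ : KolyvaginHeegnerData Dt β ι 1) (hy : ¬ IsOfFinAddOrder d₁.derivedPoint) (M₀ : ℕ)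
    (hdiv : ∃ Q : (W.baseChange (ringClassField K ι 1)).toAffine.Point,
      ((3 ^ M₀ : ℕ) : ℤ) • Q = d₁.derivedPoint)
    (hndiv : ¬ ∃ Q : (W.baseChange (ringClassField K ι 1)).toAffine.Point,
      ((3 ^ (M₀ + 1) : ℕ) : ℤ) • Q = d₁.derivedPoint)
    (ℓ : ℕ) (d : KolyvaginHeegnerData Dt β ι ℓ)
    (hℓ : Zhang2014.IsKolyvaginPrime (W.conductorNorm ℤ) W K 3 ℓ)
    (hcert : ¬ ∃ Q : (W.baseChange (ringClassField K ι ℓ)).toAffine.Point,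
      ((3 : ℕ) : ℤ) • Q = d.derivedPoint)
    {q : ℚ} (hq : shaAn W = (q : ℂ)) (hv : padicValRat 3 q = 0) : P2OpenInputOnTreeOddAt W 3 :=
  P2.openInputOnTreeOddAt_of_bsdp_of_ram W 3 hGZ hKo hSk hGZK hmod hC hram
    (bsdp_three_of_mccallumCertificate W hMc hGZK hnf hX K hK hD3 hD4 hH htower Dt β ι d₁ hy M₀
      hdiv hndiv ℓ d hℓ hcert hq hv)

end OpenInput

end Summit.BirchSwinnertonDyer.Rank1Residual.X11b.Three

end
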